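import Mathlib
import HarnessLib
import Summits.QuantumFields.YangMills.Theses.SlowBitWindow
import Summits.QuantumFields.YangMills.Theorems.LuscherReductionRunningReductionTraceFormula
import Summits.QuantumFields.YangMills.Theorems.FemtoTransferGapBounds
import Summits.QuantumFields.YangMills.Theorems.FemtoTransferGapPositivity

/-!
# SlowBitWindow — the Assembly item (pure algebra)

`assembly_holds : Theses.SlowBitWindow.Assembly`, i.e.
`TraceDoor → JensenDoor → StepPersistence → SubFemtoEntropy → ThermalTraceWindow.SubFemtoFirstLevel`.

From `StepPersistence` pick the slow odd bit `O`; `JensenDoor` and `TraceDoor` give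
`β^(-k) Z(2L)^L ≤ (insTrace O 1)^L ≤ 2 λ₁^L Z(L) Z(2L)^(L-1)`, hence `β^(-k) Z(2L) ≤ 2 λ₁^L Z(L)`;
`λ₀^(2L) ≤ Z(2L)` (trace formula `TT.traceFormula_all`) and `SubFemtoEntropy` `Z(L) ≤ β^q λ₀^L` give
`β^(-(k+q+1)) λ₀^L ≤ λ₁^L` for `β ≥ 2`. D-0145 line g10-A of seat ym-idea-4; no summit is proved here.
-/

open MeasureTheory
open Literature.MathematicalPhysics.QuantumFieldTheory
open Literature.MathematicalPhysics.QuantumLattice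
open scoped BigOperators

namespace Summit.QuantumFields.YangMills.Theses.SlowBitWindow

open Summit.QuantumFields.YangMills.Theorems.FemtoTransferGap
open Summit.QuantumFields.YangMills.Theorems.FemtoTransferGap.TT

/-- `(β ^ (-k/L)) ^ L = β ^ (-k)` for `β > 0`, `L ≠ 0`. -/
private lemma rpow_neg_div_pow {β k : ℝ} (hβ : 0 < β) {L : ℕ} (hL : L ≠ 0) :
    (β ^ (-k / L)) ^ L = β ^ (-k) := by
  rw [← Real.rpow_natCast, ← Real.rpow_mul hβ.le]
  congr 1
  field_simp

/-- **Assembly holds**: TraceDoor → JensenDoor → StepPersistence → SubFemtoEntropy → `ThermalTraceWindow.SubFemtoFirstLevel`. -/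
theorem assembly_holds : Assembly := by
  intro hD hJ hP hE A hA
  obtain ⟨k, β₁, L₁, hP'⟩ := hP A hA
  obtain ⟨q, β₂, L₂, hE'⟩ := hE A hA
  refine ⟨k + q + 1, max (max β₁ β₂) 2, max (max L₁ L₂) 2, ?_⟩
  intro β hβ L _ hL hLA
  simp only [max_le_iff] at hβ hL
  obtain ⟨⟨hβ₁, hβ₂⟩, hβ2⟩ := hβ
  obtain ⟨⟨hL₁, hL₂⟩, hL2⟩ := hL
  have hβpos : 0 < β := by linarith
  have hβ1 : (1 : ℝ) ≤ β := by linarith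
  have hLne : L ≠ 0 := by omega
  obtain ⟨O, hO, hO1, hOodd, hstep⟩ := hP' β hβ₁ L hL₁ hLA
  have hent : physTrace L β L ≤ β ^ q * levelValue su2Rep L β 0 ^ L := hE' β hβ₂ L hL₂ hLA
  have hdoor : insTrace L β O L ≤ 2 * levelValue su2Rep L β 1 ^ L * physTrace L β L := hD L hL2 β hβ1 O hO hO1 hOodd
  have hjen : insTrace L β O 1 ^ L ≤ insTrace L β O L * physTrace L β (2 * L) ^ (L - 1) := hJ L hL2 β hβ1 O hO hO1
  -- positivity of levels and traces (proved tree facts)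
  have hlam0 : 0 < levelValue su2Rep L β 0 := levelValue_zero_su2Rep_pos L β
  have hlamnn : ∀ j, 0 ≤ levelValue su2Rep L β j := fun j =>
    levelValue_nonneg_of_qform_nonneg su2Rep β (fun ψ hψ => qform_su2Rep_self_nonneg hβpos.le hψ) j
  have hTF := TT.traceFormula_all
  have hZ1 : levelValue su2Rep L β 0 ^ L ≤ physTrace L β L :=
    le_hasSum (hTF L β L hβ1 hL2) 0 (fun j _ => pow_nonneg (hlamnn j) _)
  have hZ2 : levelValue su2Rep L β 0 ^ (2 * L) ≤ physTrace L β (2 * L) :=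
    le_hasSum (hTF L β (2 * L) hβ1 (by omega)) 0 (fun j _ => pow_nonneg (hlamnn j) _)
  have hZ2pos : 0 < physTrace L β (2 * L) := lt_of_lt_of_le (pow_pos hlam0 _) hZ2
  set Z₁ := physTrace L β L with hZ₁def
  set Z₂ := physTrace L β (2 * L) with hZ₂def
  set l0 := levelValue su2Rep L β 0 with hl0def
  set l1 := levelValue su2Rep L β 1 with hl1def
  have hl1nn : 0 ≤ l1 ^ L := pow_nonneg (hlamnn 1) _
  -- the chain `(β^{-k/L} Z₂)^L ≤ I₁^L ≤ I_L Z₂^{L-1} ≤ 2 λ₁^L Z₁ Z₂^{L-1}`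
  have hδpos : 0 < β ^ (-k / (L : ℝ)) := Real.rpow_pos_of_pos hβpos _
  have h1 : (β ^ (-k / (L : ℝ)) * Z₂) ^ L ≤ insTrace L β O 1 ^ L :=
    pow_le_pow_left₀ (by positivity) hstep L
  have hZ2pow : 0 ≤ Z₂ ^ (L - 1) := pow_nonneg hZ2pos.le _
  have h2 : insTrace L β O L * Z₂ ^ (L - 1) ≤ 2 * l1 ^ L * Z₁ * Z₂ ^ (L - 1) :=
    mul_le_mul_of_nonneg_right hdoor hZ2pow
  have h3 : (β ^ (-k / (L : ℝ)) * Z₂) ^ L ≤ 2 * l1 ^ L * Z₁ * Z₂ ^ (L - 1) := h1.trans (hjen.trans h2)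
  have hpow : (β ^ (-k / (L : ℝ)) * Z₂) ^ L = β ^ (-k) * (Z₂ * Z₂ ^ (L - 1)) := by
    rw [mul_pow, rpow_neg_div_pow hβpos hLne]
    congr 1
    conv_lhs => rw [show L = (L - 1) + 1 by omega]
    rw [pow_succ, mul_comm]
  rw [hpow] at h3
  -- cancel `Z₂^{L-1} > 0`
  have hZ2pow' : 0 < Z₂ ^ (L - 1) := pow_pos hZ2pos _
  have h4 : β ^ (-k) * Z₂ ≤ 2 * l1 ^ L * Z₁ := by
    have := h3
    have h' : (β ^ (-k) * Z₂) * Z₂ ^ (L - 1) ≤ (2 * l1 ^ L * Z₁) * Z₂ ^ (L - 1) := by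
      simpa [mul_assoc] using this
    exact le_of_mul_le_mul_right h' hZ2pow'
  -- insert `Z₂ ≥ λ₀^{2L}` and `Z₁ ≤ β^q λ₀^L`
  have hβk : 0 < β ^ (-k) := Real.rpow_pos_of_pos hβpos _
  have h5 : β ^ (-k) * l0 ^ (2 * L) ≤ 2 * l1 ^ L * (β ^ q * l0 ^ L) := by
    calc β ^ (-k) * l0 ^ (2 * L) ≤ β ^ (-k) * Z₂ := mul_le_mul_of_nonneg_left hZ2 hβk.le
      _ ≤ 2 * l1 ^ L * Z₁ := h4
      _ ≤ 2 * l1 ^ L * (β ^ q * l0 ^ L) := mul_le_mul_of_nonneg_left hent (by positivity)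
  -- divide by `λ₀^L > 0`
  have hl0L : 0 < l0 ^ L := pow_pos hlam0 _
  have h6 : β ^ (-k) * l0 ^ L ≤ 2 * β ^ q * l1 ^ L := by
    have h' : (β ^ (-k) * l0 ^ L) * l0 ^ L ≤ (2 * β ^ q * l1 ^ L) * l0 ^ L := by
      have e1 : β ^ (-k) * l0 ^ (2 * L) = (β ^ (-k) * l0 ^ L) * l0 ^ L := by rw [two_mul, pow_add]; ring
      have e2 : 2 * l1 ^ L * (β ^ q * l0 ^ L) = (2 * β ^ q * l1 ^ L) * l0 ^ L := by ring
      rw [← e1, ← e2]; exact h5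
    exact le_of_mul_le_mul_right h' hl0L
  -- conclude with `β^{-(k+q+1)} = β^{-k} β^{-q} β^{-1}` and `β ≥ 2`
  have hβq : 0 < β ^ q := Real.rpow_pos_of_pos hβpos _
  have hsplit : β ^ (-(k + q + 1)) = β ^ (-k) * (β ^ q)⁻¹ * β⁻¹ := by
    rw [show -(k + q + 1) = -k + -q + -1 by ring, Real.rpow_add hβpos, Real.rpow_add hβpos, Real.rpow_neg hβpos.le q,
      Real.rpow_neg_one]
  rw [hsplit]
  have hβinv : β⁻¹ ≤ 1 / 2 := by rw [inv_eq_one_div]; exact one_div_le_one_div_of_le (by norm_num) hβ2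
  have h7 : β ^ (-k) * (β ^ q)⁻¹ * l0 ^ L ≤ 2 * l1 ^ L := by
    have := div_le_div_of_nonneg_right h6 hβq.le
    have e1 : β ^ (-k) * l0 ^ L / β ^ q = β ^ (-k) * (β ^ q)⁻¹ * l0 ^ L := by ring
    have e2 : 2 * β ^ q * l1 ^ L / β ^ q = 2 * l1 ^ L := by field_simp
    rw [e1, e2] at this; exact this
  have hnn : 0 ≤ β ^ (-k) * (β ^ q)⁻¹ * l0 ^ L := by positivity
  calc β ^ (-k) * (β ^ q)⁻¹ * β⁻¹ * l0 ^ L = β⁻¹ * (β ^ (-k) * (β ^ q)⁻¹ * l0 ^ L) := by ring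
    _ ≤ (1 / 2) * (β ^ (-k) * (β ^ q)⁻¹ * l0 ^ L) := mul_le_mul_of_nonneg_right hβinv hnn
    _ ≤ (1 / 2) * (2 * l1 ^ L) := mul_le_mul_of_nonneg_left h7 (by norm_num)
    _ = l1 ^ L := by ring

end Summit.QuantumFields.YangMills.Theses.SlowBitWindow
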